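import Mathlib

/-!
# Crux `ShortCondensation` (stmt-MatrixMultiplication-15936), line `schur` —
# stub `stub_dodgsonExists`

Qualitative Dodgson condensation: a valid octahedral derivation of length `≤ n^3` listing the
target (registered stub of the line skeleton, proved verbatim).
-/

set_option linter.dupNamespace false

namespace Summit.MatrixMultiplication.MatrixMultiplication.Theorems.ShortCondensation

/-!
## Construction (Dodgson condensation, listed by increasing size)

Points are `n`-subsets of `Fin (n + n)` (maximal minors of `[I_n | X]`).  The contiguous
`h × h` minor of `X` with rows `[a, a + h)` and columns `[b, b + h)` is the point
`S a b h = ([0, n) \ [a, a + h)) ∪ (n + [b, b + h))`; all helper lemmas are stated for an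
abstract family `S` characterised by this membership condition (`hS`), which the main proof
instantiates with a `Finset.filter` (no auxiliary definitions).  We list, for `h = 2, …, n` in
increasing order, all contiguous `h × h` minors (padded to `n * n` indices per size, so the
index arithmetic is a plain `div`/`mod` decoding; duplicates are harmless).  The octahedron
witnesses at `S a b h` are `p = n + b`, `q = n + b + h - 1`, `u = a`, `v = a + h - 1`; the five
mates are the four contiguous `(h-1) × (h-1)` minors inside and the central contiguous
`(h-2) × (h-2)` minor (the six sets of Dodgson's condensation identity / Desnanot–Jacobi),
each of which is either listed earlier (size `≥ 2`) or in the ball (size `≤ 1`).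
-/

/-- The five octahedron mates of a contiguous `h × h` minor (`h ≥ 2`) at the witnesses
`p = n + b`, `q = n + b + h - 1`, `u = a`, `v = a + h - 1` are the four contiguous
`(h-1) × (h-1)` sub-minors and the central contiguous `(h-2) × (h-2)` sub-minor
(the sets entering Dodgson's condensation identity). [folklore] -/
theorem dodgson_mates {n : ℕ} (S : ℕ → ℕ → ℕ → Finset (Fin (n + n)))
    (hS : ∀ (a b h : ℕ) (x : Fin (n + n)), x ∈ S a b h ↔
      (x.val < n ∧ ¬(a ≤ x.val ∧ x.val < a + h)) ∨ (n + b ≤ x.val ∧ x.val < n + b + h))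
    (a b h : ℕ) (h2 : 2 ≤ h) (ha : a + h ≤ n)
    (p q u v : Fin (n + n)) (hp : p.val = n + b) (hq : q.val = n + b + h - 1) (hu : u.val = a)
    (hv : v.val = a + h - 1) :
    insert u ((S a b h).erase p) = S (a + 1) (b + 1) (h - 1) ∧
    insert v ((S a b h).erase p) = S a (b + 1) (h - 1) ∧
    insert u ((S a b h).erase q) = S (a + 1) b (h - 1) ∧
    insert v ((S a b h).erase q) = S a b (h - 1) ∧
    insert u (insert v (((S a b h).erase p).erase q)) = S (a + 1) (b + 1) (h - 2) := by
  refine ⟨?_, ?_, ?_, ?_, ?_⟩ <;> ext ⟨x, hx⟩ <;>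
    simp only [Finset.mem_insert, Finset.mem_erase, hS, Fin.ext_iff, hp, hq, hu, hv, ne_eq] <;>
    omega

/-- Decoding of the padded index `t * n² + (a * n + b)` (`a, b < n`). [folklore] -/
theorem dodgson_decode {n : ℕ} (t a b : ℕ) (ha : a < n) (hb : b < n) :
    (t * (n * n) + (a * n + b)) / (n * n) = t ∧
    (t * (n * n) + (a * n + b)) / n % n = a ∧
    (t * (n * n) + (a * n + b)) % n = b ∧
    t * (n * n) + (a * n + b) < (t + 1) * (n * n) := by
  have hn : 0 < n := by omega
  have hr : a * n + b < n * n :=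
    calc a * n + b < a * n + n := by omega
      _ = (a + 1) * n := by ring
      _ ≤ n * n := Nat.mul_le_mul_right n ha
  refine ⟨?_, ?_, ?_, ?_⟩
  · rw [Nat.add_comm, Nat.add_mul_div_right _ _ (Nat.mul_pos hn hn), Nat.div_eq_of_lt hr,
      Nat.zero_add]
  · have e : (t * (n * n) + (a * n + b)) / n = t * n + a := by
      rw [show t * (n * n) + (a * n + b) = b + (t * n + a) * n by ring,
        Nat.add_mul_div_right _ _ hn, Nat.div_eq_of_lt hb, Nat.zero_add]
    rw [e, Nat.add_comm, Nat.add_mul_mod_self_right]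
    exact Nat.mod_eq_of_lt ha
  · rw [show t * (n * n) + (a * n + b) = b + (t * n + a) * n by ring, Nat.add_mul_mod_self_right]
    exact Nat.mod_eq_of_lt hb
  · have e : (t + 1) * (n * n) = t * (n * n) + n * n := by ring
    omega

/-- A contiguous minor inside the `n × n` frame is a point: it has exactly `n` elements.
[folklore] -/
theorem dodgson_card {n : ℕ} (S : ℕ → ℕ → ℕ → Finset (Fin (n + n)))
    (hS : ∀ (a b h : ℕ) (x : Fin (n + n)), x ∈ S a b h ↔
      (x.val < n ∧ ¬(a ≤ x.val ∧ x.val < a + h)) ∨ (n + b ≤ x.val ∧ x.val < n + b + h))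
    (a b h : ℕ) (ha : a + h ≤ n) (hb : b + h ≤ n) : (S a b h).card = n := by
  apply Finset.card_eq_of_bijective
    (fun i hi => if hc : a ≤ i ∧ i < a + h then (⟨n + b + (i - a), by omega⟩ : Fin (n + n))
      else ⟨i, by omega⟩)
  · intro x hx
    rw [hS] at hx
    rcases hx with hx | hx
    · exact ⟨x.val, hx.1, by rw [dif_neg hx.2]⟩
    · refine ⟨a + (x.val - (n + b)), by omega, ?_⟩
      rw [dif_pos (by omega)]
      ext
      dsimp only
      omega
  · intro i hi
    rw [hS]
    split_ifs with h1
    · right; dsimp only; omega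
    · left; exact ⟨hi, h1⟩
  · intro i j hi hj hij
    split_ifs at hij with h1 h2 h2 <;> simp only [Fin.mk.injEq] at hij <;> omega

/-- Minors of size `≤ 1` lie in the ball: they meet the column block `[n, 2n)` in at most one
element. [folklore] -/
theorem dodgson_filter_le_one {n : ℕ} (S : ℕ → ℕ → ℕ → Finset (Fin (n + n)))
    (hS : ∀ (a b h : ℕ) (x : Fin (n + n)), x ∈ S a b h ↔
      (x.val < n ∧ ¬(a ≤ x.val ∧ x.val < a + h)) ∨ (n + b ≤ x.val ∧ x.val < n + b + h))
    (a b h : ℕ) (hh : h ≤ 1) : ((S a b h).filter fun x : Fin (n + n) => n ≤ x.val).card ≤ 1 := by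
  refine Finset.card_le_one.mpr fun x hx y hy => ?_
  simp only [Finset.mem_filter, hS] at hx hy
  exact Fin.ext (by omega)

/-- The full `n × n` minor is the target `[n, 2n)` (`= det X`). [folklore] -/
theorem dodgson_target {n : ℕ} (S : ℕ → ℕ → ℕ → Finset (Fin (n + n)))
    (hS : ∀ (a b h : ℕ) (x : Fin (n + n)), x ∈ S a b h ↔
      (x.val < n ∧ ¬(a ≤ x.val ∧ x.val < a + h)) ∨ (n + b ≤ x.val ∧ x.val < n + b + h)) :
    S 0 0 n = Finset.univ.filter fun x : Fin (n + n) => n ≤ x.val := by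
  ext ⟨x, hx⟩
  simp only [hS, Finset.mem_filter, Finset.mem_univ, true_and]
  omega

/-- Every entry of the padded listing (index `i < (n - 1) * n²`: size `h = i / n² + 2`, row
offset `(i / n) % n` and column offset `i % n`, both clamped to `n - h`) is a contiguous minor
of some size `h ≥ 2` inside the frame, and all indices below `(h - 2) * n²` come before it.
[folklore] -/
theorem dodgson_f_spec {n : ℕ} (S : ℕ → ℕ → ℕ → Finset (Fin (n + n))) (hn : 2 ≤ n) (i : ℕ)
    (hi : i < (n - 1) * (n * n)) :
    ∃ a b h, 2 ≤ h ∧ a + h ≤ n ∧ b + h ≤ n ∧ (h - 2) * (n * n) ≤ i ∧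
      S (min (i / n % n) (n - (i / (n * n) + 2))) (min (i % n) (n - (i / (n * n) + 2)))
        (i / (n * n) + 2) = S a b h := by
  have hn0 : 0 < n := by omega
  have ht : i / (n * n) < n - 1 := (Nat.div_lt_iff_lt_mul (Nat.mul_pos hn0 hn0)).mpr hi
  have hle : i / (n * n) * (n * n) ≤ i := Nat.div_mul_le_self i (n * n)
  refine ⟨min (i / n % n) (n - (i / (n * n) + 2)), min (i % n) (n - (i / (n * n) + 2)),
    i / (n * n) + 2, Nat.le_add_left 2 _, ?_, ?_, by simpa using hle, rfl⟩
  · generalize i / (n * n) = t at *; generalize i / n % n = s at *; omega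
  · generalize i / (n * n) = t at *; generalize i % n = s at *; omega

/-- The contiguous `h × h` minor at `(a, b)` (`h ≥ 2`) is listed at the padded index
`(h - 2) * n² + (a * n + b) < (h - 1) * n²`. [folklore] -/
theorem dodgson_f_hit {n : ℕ} (S : ℕ → ℕ → ℕ → Finset (Fin (n + n))) (a b h : ℕ) (h2 : 2 ≤ h)
    (ha : a + h ≤ n) (hb : b + h ≤ n) :
    S (min (((h - 2) * (n * n) + (a * n + b)) / n % n)
          (n - (((h - 2) * (n * n) + (a * n + b)) / (n * n) + 2)))
        (min (((h - 2) * (n * n) + (a * n + b)) % n)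
          (n - (((h - 2) * (n * n) + (a * n + b)) / (n * n) + 2)))
        (((h - 2) * (n * n) + (a * n + b)) / (n * n) + 2) = S a b h ∧
      (h - 2) * (n * n) + (a * n + b) < (h - 1) * (n * n) := by
  obtain ⟨d1, d2, d3, d4⟩ := dodgson_decode (n := n) (h - 2) a b (by omega) (by omega)
  refine ⟨?_, by simpa [show h - 2 + 1 = h - 1 by omega] using d4⟩
  rw [d1, d2, d3, show h - 2 + 2 = h by omega, min_eq_left (by omega), min_eq_left (by omega)]

/-- A contiguous minor of size `k < h` inside the frame is either in the ball (`k ≤ 1`) or a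
contiguous minor of some size `h'` with `2 ≤ h' < h`. [folklore] -/
theorem dodgson_ball_or_lt {n : ℕ} (S : ℕ → ℕ → ℕ → Finset (Fin (n + n)))
    (hS : ∀ (a b h : ℕ) (x : Fin (n + n)), x ∈ S a b h ↔
      (x.val < n ∧ ¬(a ≤ x.val ∧ x.val < a + h)) ∨ (n + b ≤ x.val ∧ x.val < n + b + h))
    (a b h k : ℕ) (hk : k < h) (ha : a + k ≤ n) (hb : b + k ≤ n) :
    ((S a b k).card = n ∧ ((S a b k).filter fun x : Fin (n + n) => n ≤ x.val).card ≤ 1) ∨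
      ∃ a' b' h', 2 ≤ h' ∧ h' < h ∧ a' + h' ≤ n ∧ b' + h' ≤ n ∧ S a b k = S a' b' h' := by
  by_cases hk1 : k ≤ 1
  · exact Or.inl ⟨dodgson_card S hS a b k ha hb, dodgson_filter_le_one S hS a b k hk1⟩
  · exact Or.inr ⟨a, b, k, by omega, hk, ha, hb, rfl⟩

/-- **Dodgson's condensation step is a valid exchange step.**  The contiguous `h × h` minor
(`h ≥ 2`) inside the frame has octahedron witnesses `p ≠ q` in it and `u ≠ v` outside it whose
five mates are each in the ball or a contiguous minor of size in `[2, h)`. [folklore] -/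
theorem dodgson_valid {n : ℕ} (S : ℕ → ℕ → ℕ → Finset (Fin (n + n)))
    (hS : ∀ (a b h : ℕ) (x : Fin (n + n)), x ∈ S a b h ↔
      (x.val < n ∧ ¬(a ≤ x.val ∧ x.val < a + h)) ∨ (n + b ≤ x.val ∧ x.val < n + b + h))
    (a b h : ℕ) (h2 : 2 ≤ h) (ha : a + h ≤ n) (hb : b + h ≤ n) :
    ∃ p ∈ S a b h, ∃ q ∈ S a b h, p ≠ q ∧ ∃ u ∉ S a b h, ∃ v ∉ S a b h, u ≠ v ∧
    ∀ J ∈ [insert u ((S a b h).erase p), insert v ((S a b h).erase p),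
        insert u ((S a b h).erase q), insert v ((S a b h).erase q),
        insert u (insert v (((S a b h).erase p).erase q))],
      (J.card = n ∧ (J.filter fun x : Fin (n + n) => n ≤ x.val).card ≤ 1) ∨
      ∃ a' b' h', 2 ≤ h' ∧ h' < h ∧ a' + h' ≤ n ∧ b' + h' ≤ n ∧ J = S a' b' h' := by
  obtain ⟨m1, m2, m3, m4, m5⟩ := dodgson_mates S hS a b h h2 ha ⟨n + b, by omega⟩
    ⟨n + b + h - 1, by omega⟩ ⟨a, by omega⟩ ⟨a + h - 1, by omega⟩ rfl rfl rfl rfl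
  refine ⟨⟨n + b, by omega⟩, ?_, ⟨n + b + h - 1, by omega⟩, ?_, ?_, ⟨a, by omega⟩, ?_,
    ⟨a + h - 1, by omega⟩, ?_, ?_, ?_⟩
  · rw [hS]; dsimp only; omega
  · rw [hS]; dsimp only; omega
  · rw [ne_eq, Fin.ext_iff]; dsimp only; omega
  · rw [hS]; dsimp only; omega
  · rw [hS]; dsimp only; omega
  · rw [ne_eq, Fin.ext_iff]; dsimp only; omega
  · intro J hJ
    simp only [List.mem_cons, List.not_mem_nil, or_false] at hJ
    rcases hJ with rfl | rfl | rfl | rfl | rfl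
    · rw [m1]
      exact dodgson_ball_or_lt S hS (a + 1) (b + 1) h (h - 1) (by omega) (by omega) (by omega)
    · rw [m2]
      exact dodgson_ball_or_lt S hS a (b + 1) h (h - 1) (by omega) (by omega) (by omega)
    · rw [m3]
      exact dodgson_ball_or_lt S hS (a + 1) b h (h - 1) (by omega) (by omega) (by omega)
    · rw [m4]
      exact dodgson_ball_or_lt S hS a b h (h - 1) (by omega) (by omega) (by omega)
    · rw [m5]
      exact dodgson_ball_or_lt S hS (a + 1) (b + 1) h (h - 2) (by omega) (by omega) (by omega)

/-- **Qualitative Dodgson condensation (recursion floor of `ShortCondensation`).**  For every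
`n ≥ 2` there is a valid octahedral derivation of length `≤ n³` in the exchange graph of
`n`-subsets of `Fin (n + n)` (points = maximal minors of `[I_n | X]`, ball = the entries of `X`
and the empty minor) that lists the target `[n, 2n)` (`= det X`): list all contiguous minors
of `X` by increasing size; each is certified by Dodgson's condensation identity
(Desnanot–Jacobi: `M · M^{1,h}_{1,h} = M^1_1 M^h_h − M^1_h M^h_1` for the contiguous
sub-minors), whose five other terms are smaller contiguous minors, hence listed earlier or in
the ball.  The listing used has exactly `(n - 1) · n²` (padded) entries.  Sources: C. L.
Dodgson, *Condensation of determinants*, Proc. Roy. Soc. London 15 (1866/67) 150–155;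
E. H. Bareiss, Math. Comp. 22 (1968) 565–578. [folklore] -/
theorem stub_dodgsonExists :
    ∀ n : ℕ, 2 ≤ n → ∃ (l : ℕ) (f : Fin l → Finset (Fin (n + n))), l ≤ n ^ 3 ∧
      (∀ i : Fin l, ∃ p ∈ f i, ∃ q ∈ f i, p ≠ q ∧ ∃ u ∉ f i, ∃ v ∉ f i, u ≠ v ∧ ∀ J ∈ [insert u ((f i).erase p), insert v ((f i).erase p), insert u ((f i).erase q), insert v ((f i).erase q), insert u (insert v (((f i).erase p).erase q))], (J.card = n ∧ (J.filter fun x : Fin (n + n) => n ≤ x.val).card ≤ 1) ∨ ∃ j : Fin l, j < i ∧ f j = J) ∧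
      ∃ i : Fin l, f i = Finset.univ.filter fun x : Fin (n + n) => n ≤ x.val := by
  intro n hn
  obtain ⟨S, hS⟩ : ∃ S : ℕ → ℕ → ℕ → Finset (Fin (n + n)), ∀ (a b h : ℕ) (x : Fin (n + n)),
      x ∈ S a b h ↔
        (x.val < n ∧ ¬(a ≤ x.val ∧ x.val < a + h)) ∨ (n + b ≤ x.val ∧ x.val < n + b + h) :=
    ⟨fun a b h => Finset.univ.filter fun x =>
        (x.val < n ∧ ¬(a ≤ x.val ∧ x.val < a + h)) ∨ (n + b ≤ x.val ∧ x.val < n + b + h),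
      fun a b h x => by simp⟩
  refine ⟨(n - 1) * (n * n), fun i => S (min (i.val / n % n) (n - (i.val / (n * n) + 2)))
    (min (i.val % n) (n - (i.val / (n * n) + 2))) (i.val / (n * n) + 2), ?_, ?_, ?_⟩
  · calc (n - 1) * (n * n) ≤ n * (n * n) := Nat.mul_le_mul_right _ (Nat.sub_le n 1)
      _ = n ^ 3 := by ring
  · intro i
    obtain ⟨a, b, h, h2, ha, hb, hle, hfi⟩ := dodgson_f_spec S hn i.val i.isLt
    dsimp only
    rw [hfi]
    obtain ⟨p, hp, q, hq, hpq, u, hu, v, hv, huv, hall⟩ := dodgson_valid S hS a b h h2 ha hb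
    refine ⟨p, hp, q, hq, hpq, u, hu, v, hv, huv, fun J hJ => (hall J hJ).imp_right ?_⟩
    rintro ⟨a', b', h', h2', hlt, ha', hb', rfl⟩
    obtain ⟨hidx, hlt'⟩ := dodgson_f_hit S a' b' h' h2' ha' hb'
    have hle' : (h' - 1) * (n * n) ≤ (h - 2) * (n * n) := Nat.mul_le_mul_right _ (by omega)
    exact ⟨⟨(h' - 2) * (n * n) + (a' * n + b'), by omega⟩, Fin.mk_lt_of_lt_val (by omega), hidx⟩
  · obtain ⟨hidx, hlt⟩ := dodgson_f_hit S 0 0 n hn (by omega) (by omega)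
    exact ⟨⟨(n - 2) * (n * n) + (0 * n + 0), hlt⟩, hidx.trans (dodgson_target S hS)⟩

end Summit.MatrixMultiplication.MatrixMultiplication.Theorems.ShortCondensation
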